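/-
Copyright (c) 2026 the pub-hodgecm-mathlib formalisation cell (harness21).  Prover seat hodgecm-mathlib-K2Liu-p12 (g4): Track B «K2-LIT»,
#184♮ = hLiu418 = stmt-HodgeConjecture-24832; Road Φ of socket #41, Φ9 consumer sheet «G3-inst» brick B3 = (I-4) (LEAD F0P6-plan (g14) BATCH #32 (4));
census `K2/K2Liu-p12/g4/CENSUS-G3inst-SkewCarrierBridge.K2Liu-p12-g4.md`.  File B3.
-/
import Literature.NumberTheory.Automorphic.QuadraticLocalNormCompatibility        -- ★ `quadraticLocalEquiv`, `algebraLocalRing`, `conjLocal_*`, the norm pattern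
import Literature.NumberTheory.Automorphic.AdelicAdditiveCharacter               -- ★ Tate's `adeleAddChar`, `adeleAddCharAt`, `adeleTraceMod_eq`, `exists_isFiniteIntegral_sub_algebraMap`
import Literature.NumberTheory.Automorphic.GlobalAdditiveCharacter               -- ★ `AddChar.adicComponent` (= `adeleAddCharAt` definitionally)
import Literature.NumberTheory.GelbartRogawski1991.Prop311PrintedSymplecticFrame -- ★ `Prop311.algebraMap_trace_eq_add` (`Tr_{E/F} e = e + σ e`)
import Mathlib.RingTheory.Trace.Basic
import HarnessLib

/-!
# Crux `HLiu418`, Road Φ of socket #41, «G3-inst» brick B3 — TATE'S LOCAL TRACE COMPATIBILITY: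
# `∏_{w∣v} ψ_{E,w}(y_w) = ψ_{F,v}(Tr_{E⊗F_v/F_v} y)` for a quadratic extension `E/F` of number fields, and the local trace `Tr = y + ȳ`

Cell `hodgecm-mathlib`, crux item hLiu418 = `stmt-HodgeConjecture-24832`, route of record `HCCMUnconditional`; squad K2 ∕ K2Liu, road `K2_Liu`,
socket #41 `sig_K2LiuSiegelEisensteinContinuation`, Road Φ; consumer = ★∕📤 B4 `K2LiuLocalWhittakerFactorSkew.integral_unipDeltaLoc_eq_integral_skew_addChar`
(its ONE by-value letter `hΨ : ∀ x, ∏_{w∣v} (adeleAddChar L).adicComponent w (x w) = ψ (τ x)`) and the `τ`-letters (`hτ`, `hτs`, `hτadd`, `hτc`) of ★ Φ4∕Φ5∕E7∕R1.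
THEOREMS ONLY (no `def`, no `instance`, no `notation`, no named-fact hypothesis, no `sorry`); lane `--supports stmt-HodgeConjecture-24832` (count-neutral helper).

THE MATHEMATICS [CasselsFrohlichANT1967, Ch. XV (Tate) §2.2, §4.1], [CasselsFrohlichANT1967, Ch. II §11].  `E/F` quadratic with `σ`, `v` a finite place of `F`,
`E ⊗_F F_v = ∏_{w∣v} E_w` (★ `LocalRing E v`, an `F_v`-algebra of rank `2`, ★ `algebraLocalRing`, ★ `quadraticLocalEquiv`).  The LOCAL TRACE is Mathlib's
`Algebra.trace (v.adicCompletion F) (LocalRing E v)` — nothing is defined here.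
* §1 `algebraTrace_quadraticLocalEquiv` (`Tr(ι a + ι b·δ) = a + a`, the matrix `(a, db; b, a)`), **`toLocalRing_algebraTrace`** (`ι_v(Tr y) = y + (σ⊗1) y` — the `hτ`
  letter), **`algebraTrace_localRing_algebraMap`** (`Tr(x ⊗ 1) = Tr_{E/F} x`, base change; ★ `Prop311.algebraMap_trace_eq_add`), **`algebraTrace_mem_adicCompletionIntegers`**
  (`Tr(∏_w 𝒪_w) ⊆ 𝒪_v`; ★ `valued_galAdicCompletionMap`, ★ `valued_toPlace`), `algebraTrace_toLocalRing_mul` (`F_v`-linearity, the `hτs` letter), `continuous_algebraTrace_localRing`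
  (the `hτc` letter: `Tr = 2·pr₁ ∘ Ψ⁻¹` for the homeomorphism `Ψ = quadraticLocalEquiv`).
* §2 **`prod_adeleAddCharAt_eq_adeleAddCharAt_trace`** — for every `y ∈ ∏_{w∣v} E_w`:  `∏_{w∣v} ψ_{E,w}(y_w) = ψ_{F,v}(Tr y)`, `ψ_K,v = ` ★ `adeleAddCharAt K v` the local
  component of Tate's character ★ `adeleAddChar K`.  ADELIC PROOF: `∏_w ψ_{E,w}(y_w) = ψ_E(a)`, `a := Σ_w (y_w at w)` (★ `adeleSingleHom`); ★
  `exists_isFiniteIntegral_sub_algebraMap` gives `k ∈ E` with `a − k ∈ E_∞ × ∏ 𝒪`, so `ψ_E(a) = e(Tr_{E/ℚ} k)` (★ `adeleTraceMod_eq`, ★ `infiniteAdeleTrace_algebraMap`);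
  with `t := Tr_{E/F} k`, `(Tr y at v) − t ∈ F_∞ × ∏ 𝒪` (§1: at `v`, `Tr y − t = Tr(y − k⊗1)` with `y_w − k ∈ 𝒪_w`; at `v′ ≠ v`, `t = Tr_{v′}(k ⊗ 1)` with `k ∈ 𝒪_{w′}`), so
  `ψ_{F,v}(Tr y) = e(Tr_{F/ℚ} t) = e(Tr_{E/ℚ} k)` (★ `adeleAddCharAt_eq_of_sub_mem`, Mathlib `Algebra.trace_trace`).  Corollary **`prod_adicComponent_adeleAddChar_eq`** in the
  `AddChar.adicComponent` spelling of ★ (d1)∕B4 (definitionally the same character) = B4's `hΨ` with `ψ := adeleAddCharAt F v`, `τ := Algebra.trace F_v (E ⊗ F_v)`.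
NOT HERE: the conductor letter — ★ `AdeleAddCharUnramified.adicComponent_adeleAddChar_unramified` already gives «`ψ_{F,v}` trivial on `𝒪_v`, non-trivial on `ϖ⁻¹𝒪_v`» off the
different of `F/ℚ` (finitely many places, ★ `exists_finset_adicComponent_adeleAddChar_unramified`).
HONEST LABEL.  Count-neutral helper; it retires nothing by itself: `HC_CM` is proved only modulo the 7 printed citations (2 remaining named inputs:
hLiu418 = `stmt-HodgeConjecture-24832`, h413 = `stmt-HodgeConjecture-24833`) until rung 0 closes.

## References
* [CasselsFrohlichANT1967] J. Tate, *Fourier analysis in number fields and Hecke's zeta-functions*, in Cassels–Fröhlich (eds.), *Algebraic Number Theory* (1967),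
  Ch. XV §2.2 (local characters `λ_𝔭 ∘ Tr`), §4.1 (Thm. 4.1.1, Lemma 4.1.3); and Ch. II (Cassels) §11 (`E ⊗_F F_v = ∏_{w∣v} E_w`, local traces).
* [NeukirchANT1999] J. Neukirch, *Algebraic Number Theory* (1999): Ch. II (8.3)–(8.4) (trace under completion), Ch. I §2 (2.6).
-/

set_option autoImplicit false
-- the mandated namespace repeats the single-problem summit's segment (`HodgeConjecture.HodgeConjecture`)
set_option linter.dupNamespace false

noncomputable section

open NumberField IsDedekindDomain
open Literature.NumberTheory.Automorphic Literature.NumberTheory.Automorphic.UnitaryGroup Literature.NumberTheory.GaloisRepresentations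
open Literature.NumberTheory.GelbartRogawski1991

namespace Summit.HodgeConjecture.HodgeConjecture.Cruxes.HLiu418.K2LiuTateCharacterLocalTrace

variable {F : Type} (E : Type) [Field F] [NumberField F] [Field E] [NumberField E] [Algebra F E]
  [Algebra.IsQuadraticExtension F E] (v : HeightOneSpectrum (𝓞 F))

/-! ## §1 The local trace `Tr_{E⊗F_v/F_v}` on `∏_{w∣v} E_w` -/

section LocalTrace

/-- **the trace form in the coordinates `(1, δ)`**: `Tr_{E⊗F_v/F_v}(ι_v a + ι_v b·δ) = a + a` (trace of the matrix `(a, db; b, a)` of multiplication by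
`ι a + ι b δ` in the `F_v`-basis `(1, δ ⊗ 1)`; the twin of ★ `algebraNorm_quadraticLocalEquiv`). [cite: CasselsFrohlichANT1967, Ch. II §11] -/
theorem algebraTrace_quadraticLocalEquiv (σ : E ≃ₐ[F] E) {δ : E} (hσδ : σ δ = -δ) (hδ : δ ≠ 0) {d : F}
    (hd : δ * δ = algebraMap F E d) (a b : v.adicCompletion F) :
    Algebra.trace (v.adicCompletion F) (LocalRing E v) (quadraticLocalEquiv E v σ hσδ hδ (a, b)) = a + a := by
  classical
  set Ψ := quadraticLocalEquiv E v σ hσδ hδ with hΨ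
  let e : LocalRing E v ≃ₗ[v.adicCompletion F] (Fin 2 → v.adicCompletion F) :=
    Ψ.symm.toLinearEquiv ≪≫ₗ (LinearEquiv.finTwoArrow (v.adicCompletion F) (v.adicCompletion F)).symm
  let bs : Module.Basis (Fin 2) (v.adicCompletion F) (LocalRing E v) := Module.Basis.ofEquivFun e
  have he : ∀ p : v.adicCompletion F × v.adicCompletion F, e (Ψ p) = ![p.1, p.2] := fun p => by
    simp only [e, LinearEquiv.trans_apply, ContinuousLinearEquiv.coe_toLinearEquiv,
      ContinuousLinearEquiv.symm_apply_apply, LinearEquiv.finTwoArrow_symm_apply]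
  have hsymm : ∀ f : Fin 2 → v.adicCompletion F, e.symm f = Ψ (f 0, f 1) := fun f => by
    apply e.injective
    rw [LinearEquiv.apply_symm_apply, he]
    ext i
    fin_cases i <;> rfl
  have hb0 : bs 0 = 1 := by
    simp only [bs, Module.Basis.coe_ofEquivFun]
    rw [hsymm, Pi.single_eq_same, Pi.single_eq_of_ne (by decide : (1 : Fin 2) ≠ 0), hΨ,
      quadraticLocalEquiv_apply, map_one, map_zero, zero_mul, add_zero]
  have hb1 : bs 1 = algebraMap E (LocalRing E v) δ := by
    simp only [bs, Module.Basis.coe_ofEquivFun]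
    rw [hsymm, Pi.single_eq_same, Pi.single_eq_of_ne (by decide : (0 : Fin 2) ≠ 1), hΨ,
      quadraticLocalEquiv_apply, map_one, map_zero, one_mul, zero_add]
  rw [Algebra.trace_eq_matrix_trace bs, Matrix.trace_fin_two, Algebra.leftMulMatrix_eq_repr_mul, Algebra.leftMulMatrix_eq_repr_mul,
    hb0, hb1, mul_one, mul_comm (Ψ (a, b)) (algebraMap E (LocalRing E v) δ), algebraMap_mul_quadraticLocalEquiv E v σ hσδ hδ hd, ← hΨ]
  simp only [bs, Module.Basis.ofEquivFun_repr_apply, he, Matrix.cons_val_zero, Matrix.cons_val_one]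

/-- **`ι_v(Tr_{E⊗F_v/F_v} y) = y + (σ ⊗ 1) y`** — the trace of the quadratic étale `F_v`-algebra `∏_{w∣v} E_w` is `y + ȳ` (the `hτ` letter of the
Skew-carrier Whittaker files; twin of ★ `toLocalRing_algebraNorm`). [cite: CasselsFrohlichANT1967, Ch. II §11] -/
theorem toLocalRing_algebraTrace (σ : E ≃ₐ[F] E) {δ : E} (hσδ : σ δ = -δ) (hδ : δ ≠ 0) (y : LocalRing E v) :
    toLocalRing E v (Algebra.trace (v.adicCompletion F) (LocalRing E v) y) = y + conjLocal E σ v y := by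
  obtain ⟨d, hd⟩ := exists_mul_self_eq_algebraMap E σ hσδ hδ
  obtain ⟨⟨a, b⟩, rfl⟩ := (quadraticLocalEquiv E v σ hσδ hδ).surjective y
  rw [algebraTrace_quadraticLocalEquiv E v σ hσδ hδ hd, conjLocal_quadraticLocalEquiv, quadraticLocalEquiv_apply, quadraticLocalEquiv_apply]
  dsimp only
  simp only [map_add, map_neg]
  ring

/-- **base change: `Tr_{E⊗F_v/F_v}(x ⊗ 1) = Tr_{E/F}(x)`** (read in `F_v`; `Tr_{E/F} x = x + σ x`, ★ `Prop311.algebraMap_trace_eq_add`).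
[cite: CasselsFrohlichANT1967, Ch. II §11] [cite: NeukirchANT1999, Ch. II (8.3)–(8.4)] -/
theorem algebraTrace_localRing_algebraMap (x : E) :
    Algebra.trace (v.adicCompletion F) (LocalRing E v) (algebraMap E (LocalRing E v) x) = ((Algebra.trace F E x : F) : v.adicCompletion F) := by
  obtain ⟨σ, δ, hσδ, hδ⟩ := exists_algEquiv_apply_eq_neg (F := F) (E := E)
  apply toLocalRing_injective E v
  rw [toLocalRing_algebraTrace E v σ hσδ hδ, conjLocal_algebraMap, ← map_add, ← Prop311.algebraMap_trace_eq_add F E σ hσδ hδ, toLocalRing_coe]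

omit [Algebra.IsQuadraticExtension F E] in
/-- **`F_v`-linearity** (the `hτs` letter): `Tr(ι_v z · r) = z · Tr r` (`ι_v z · r = z • r`, ★ `smul_localRing_def`). [cite: CasselsFrohlichANT1967, Ch. II §11] -/
theorem algebraTrace_toLocalRing_mul (z : v.adicCompletion F) (r : LocalRing E v) :
    Algebra.trace (v.adicCompletion F) (LocalRing E v) (toLocalRing E v z * r) = z * Algebra.trace (v.adicCompletion F) (LocalRing E v) r := by
  rw [← smul_localRing_def, LinearMap.map_smul, smul_eq_mul]

/-- **continuity** (the `hτc` letter): `Tr = (a + a) ∘ pr₁ ∘ Ψ⁻¹` for the homeomorphism `Ψ = quadraticLocalEquiv`. [folklore] -/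
theorem continuous_algebraTrace_localRing : Continuous fun y : LocalRing E v => Algebra.trace (v.adicCompletion F) (LocalRing E v) y := by
  obtain ⟨σ, δ, hσδ, hδ⟩ := exists_algEquiv_apply_eq_neg (F := F) (E := E)
  obtain ⟨d, hd⟩ := exists_mul_self_eq_algebraMap E σ hσδ hδ
  set Ψ := quadraticLocalEquiv E v σ hσδ hδ with hΨ
  have heq : (fun y : LocalRing E v => Algebra.trace (v.adicCompletion F) (LocalRing E v) y) = fun y => (Ψ.symm y).1 + (Ψ.symm y).1 := by
    funext y
    conv_lhs => rw [← Ψ.apply_symm_apply y]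
    rw [← algebraTrace_quadraticLocalEquiv E v σ hσδ hδ hd (Ψ.symm y).1 (Ψ.symm y).2]
  rw [heq]
  have h1 : Continuous fun y : LocalRing E v => (Ψ.symm y).1 := continuous_fst.comp Ψ.symm.continuous
  exact h1.add h1

/-- **integrality: `Tr(∏_{w∣v} 𝒪_w) ⊆ 𝒪_v`** (`ι_w(Tr y) = (y + ȳ)_w ∈ 𝒪_w`, `σ` preserves integrality ★ `valued_galAdicCompletionMap`, and `v_w(ι_w t) = v_v(t)^{e(w|v)}`
★ `valued_toPlace`). [cite: CasselsFrohlichANT1967, Ch. II §11] -/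
theorem algebraTrace_mem_adicCompletionIntegers (σ : E ≃ₐ[F] E) {δ : E} (hσδ : σ δ = -δ) (hδ : δ ≠ 0) {y : LocalRing E v}
    (hy : ∀ w : PlacesOver E v, y w ∈ w.1.adicCompletionIntegers E) :
    Algebra.trace (v.adicCompletion F) (LocalRing E v) y ∈ v.adicCompletionIntegers F := by
  obtain ⟨w⟩ := UnitaryGroup.PlacesOver.nonempty E v
  -- `ι_w (Tr y) = y_w + (ȳ)_w ∈ 𝒪_w`
  have hsum : toPlace v w (Algebra.trace (v.adicCompletion F) (LocalRing E v) y) = y w + conjLocal E σ v y w := by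
    have h := congrFun (toLocalRing_algebraTrace E v σ hσδ hδ y) w
    rw [toLocalRing_apply, Pi.add_apply] at h
    exact h
  have hconj : Valued.v (conjLocal E σ v y w) ≤ 1 := by
    rw [conjLocal_apply, valued_galAdicCompletionMap]
    exact (HeightOneSpectrum.mem_adicCompletionIntegers _ _ _).1 (hy ⟨σ⁻¹ • w.1, UnitaryGroup.under_inv_smul_eq σ w⟩)
  have hyw : Valued.v (y w) ≤ 1 := (HeightOneSpectrum.mem_adicCompletionIntegers _ _ _).1 (hy w)
  have hw : Valued.v (toPlace v w (Algebra.trace (v.adicCompletion F) (LocalRing E v) y)) ≤ 1 := by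
    rw [hsum]
    exact (Valuation.map_add _ _ _).trans (max_le hyw hconj)
  rw [valued_toPlace] at hw
  haveI := PlacesOver.liesOver (E := E) w
  have he : v.asIdeal.ramificationIdx' w.1.asIdeal ≠ 0 := Ideal.IsDedekindDomain.ramificationIdx'_ne_zero_of_liesOver w.1.asIdeal v.ne_bot
  exact (HeightOneSpectrum.mem_adicCompletionIntegers _ _ _).2 (le_of_pow_le_pow_left₀ he zero_le (by rwa [one_pow]))

end LocalTrace

/-! ## §2 Tate's local trace compatibility `∏_{w∣v} ψ_{E,w}(y_w) = ψ_{F,v}(Tr y)` -/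

section Tate

omit [Algebra.IsQuadraticExtension F E] in
/-- an additive character of the adeles turns finite sums into products. [folklore] -/
theorem adeleAddChar_sum {ι : Type*} (s : Finset ι) (f : ι → AdeleRing (𝓞 E) E) :
    adeleAddChar E (∑ i ∈ s, f i) = ∏ i ∈ s, adeleAddChar E (f i) := by
  classical
  induction s using Finset.induction_on with
  | empty => rw [Finset.sum_empty, Finset.prod_empty, AddChar.map_zero_eq_one]
  | insert a s ha ih => rw [Finset.sum_insert ha, Finset.prod_insert ha, AddChar.map_add_eq_mul, ih]

omit [Algebra.IsQuadraticExtension F E] in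
/-- the `w`-component of the adele `Σ_{w′∣v} (y_{w′} at w′)` is `y_w`. [folklore] -/
theorem adeleEval_sum_adeleSingleHom_self (y : LocalRing E v) (w : PlacesOver E v) :
    AdelicGroupData.adeleEval E w.1 (∑ w' : PlacesOver E v, adeleSingleHom E w'.1 (y w')) = y w := by
  classical
  rw [map_sum, Finset.sum_eq_single w]
  · exact adeleEval_adeleSingleHom E w.1 (y w)
  · intro w' _ hw'
    exact adeleEval_adeleSingleHom_of_ne E w'.1 (y w') fun heq => hw' (Subtype.ext heq.symm)
  · intro hw; exact absurd (Finset.mem_univ _) hw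

omit [Algebra.IsQuadraticExtension F E] in
/-- the components of the adele `Σ_{w∣v} (y_w at w)` off `v` vanish. [folklore] -/
theorem adeleEval_sum_adeleSingleHom_of_ne (y : LocalRing E v) {u : HeightOneSpectrum (𝓞 E)} (hu : u.under (𝓞 F) ≠ v) :
    AdelicGroupData.adeleEval E u (∑ w' : PlacesOver E v, adeleSingleHom E w'.1 (y w')) = 0 := by
  rw [map_sum]
  refine Finset.sum_eq_zero fun w _ => adeleEval_adeleSingleHom_of_ne E w.1 (y w) fun heq => hu ?_
  rw [heq]; exact w.2

omit [Algebra.IsQuadraticExtension F E] in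
/-- the `u`-component of a principal adele is the global element (a one-line reading of Mathlib's `FiniteAdeleRing.algebraMap_apply`; kept local).
[folklore] -/
theorem adeleEval_algebraMap_eq_coe (u : HeightOneSpectrum (𝓞 E)) (k : E) :
    AdelicGroupData.adeleEval E u (algebraMap E (AdeleRing (𝓞 E) E) k) = (k : u.adicCompletion E) := by
  rw [AdelicGroupData.adeleEval_apply, adicCompletion_coe_eq_algebraMap]
  change algebraMap E (FiniteAdeleRing (𝓞 E) E) k u = _
  rw [FiniteAdeleRing.algebraMap_apply]
  exact adicCompletion_coe_eq_algebraMap (𝓞 E) E u k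

/-- **TATE'S LOCAL TRACE COMPATIBILITY.**  For a quadratic extension `E/F` of number fields, a finite place `v` of `F` and `y ∈ E ⊗_F F_v = ∏_{w∣v} E_w`:
`∏_{w∣v} ψ_{E,w}(y_w) = ψ_{F,v}(Tr_{E⊗F_v/F_v} y)`, where `ψ_{K,u}` = ★ `adeleAddCharAt K u` is the local component of Tate's standard character `ψ_K` of `𝔸_K/K`
(★ `adeleAddChar`).  Adelic proof, see the module docstring. [cite: CasselsFrohlichANT1967, Ch. XV (Tate) §2.2, §4.1] -/
theorem prod_adeleAddCharAt_eq_adeleAddCharAt_trace (y : LocalRing E v) :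
    ∏ w : PlacesOver E v, adeleAddCharAt E w.1 (y w) = adeleAddCharAt F v (Algebra.trace (v.adicCompletion F) (LocalRing E v) y) := by
  classical
  obtain ⟨σ, δ, hσδ, hδ⟩ := exists_algEquiv_apply_eq_neg (F := F) (E := E)
  haveI : FiniteDimensional F E := Module.finite_of_finrank_eq_succ (Algebra.IsQuadraticExtension.finrank_eq_two F E)
  -- the adele `a = Σ_w (y_w at w)` and its principal approximation `k`
  obtain ⟨k, hk⟩ := exists_isFiniteIntegral_sub_algebraMap E (∑ w : PlacesOver E v, adeleSingleHom E w.1 (y w))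
  have hcomp : ∀ u : HeightOneSpectrum (𝓞 E),
      AdelicGroupData.adeleEval E u (∑ w : PlacesOver E v, adeleSingleHom E w.1 (y w)) - (k : u.adicCompletion E) ∈ u.adicCompletionIntegers E := fun u => by
    have h := hk u
    change AdelicGroupData.adeleEval E u (∑ w : PlacesOver E v, adeleSingleHom E w.1 (y w) - algebraMap E (AdeleRing (𝓞 E) E) k) ∈ _ at h
    rwa [map_sub, adeleEval_algebraMap_eq_coe] at h
  -- above `v`: `y_w − k ∈ 𝒪_w`; off `v`: `k ∈ 𝒪_u`
  have hkv : ∀ w : PlacesOver E v, y w - (k : w.1.adicCompletion E) ∈ w.1.adicCompletionIntegers E := fun w => by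
    have h := hcomp w.1
    rwa [adeleEval_sum_adeleSingleHom_self] at h
  have hku : ∀ u : HeightOneSpectrum (𝓞 E), u.under (𝓞 F) ≠ v → (k : u.adicCompletion E) ∈ u.adicCompletionIntegers E := fun u hu => by
    have h := hcomp u
    rw [adeleEval_sum_adeleSingleHom_of_ne E v y hu, zero_sub] at h
    exact (neg_mem_iff).1 h
  -- `∏_w ψ_{E,w}(y_w) = ψ_E(a) = e(Tr_{E/ℚ} k)`
  have ha1 : (∑ w : PlacesOver E v, adeleSingleHom E w.1 (y w)).1 = 0 := by
    change UnitaryGroup.adeleFst E (∑ w : PlacesOver E v, adeleSingleHom E w.1 (y w)) = 0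
    rw [map_sum]
    exact Finset.sum_eq_zero fun w _ => adeleSingleHom_apply_fst E w.1 (y w)
  have hE : ∏ w : PlacesOver E v, adeleAddCharAt E w.1 (y w) = AddCircle.toCircle (((Algebra.trace ℚ E k : ℚ) : ℝ) : AddCircle (1 : ℝ)) := by
    have hprod : ∏ w : PlacesOver E v, adeleAddCharAt E w.1 (y w) = adeleAddChar E (∑ w : PlacesOver E v, adeleSingleHom E w.1 (y w)) := by
      rw [adeleAddChar_sum]
      rfl
    rw [hprod, adeleAddChar_apply, adeleTraceMod_eq E hk, AdeleRing.fst_sub, ha1, zero_sub, map_neg, AdeleRing.algebraMap_fst,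
      infiniteAdeleTrace_algebraMap, AddCircle.coe_neg, neg_neg]
  -- `ψ_{F,v}(Tr y) = e(Tr_{F/ℚ} t)`, `t = Tr_{E/F} k`
  have hv' : Algebra.trace (v.adicCompletion F) (LocalRing E v) y - ((Algebra.trace F E k : F) : v.adicCompletion F) ∈ v.adicCompletionIntegers F := by
    rw [← algebraTrace_localRing_algebraMap E v k, ← map_sub]
    refine algebraTrace_mem_adicCompletionIntegers E v σ hσδ hδ fun w => ?_
    rw [Pi.sub_apply]
    have hkw : algebraMap E (LocalRing E v) k w = (k : w.1.adicCompletion E) := (adicCompletion_coe_eq_algebraMap (𝓞 E) E w.1 k).symm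
    rw [hkw]
    exact hkv w
  have hu' : ∀ u : HeightOneSpectrum (𝓞 F), u ≠ v → ((Algebra.trace F E k : F) : u.adicCompletion F) ∈ u.adicCompletionIntegers F := fun u hu => by
    rw [← algebraTrace_localRing_algebraMap E u k]
    refine algebraTrace_mem_adicCompletionIntegers E u σ hσδ hδ fun w' => ?_
    have hkw : algebraMap E (LocalRing E u) k w' = (k : w'.1.adicCompletion E) := (adicCompletion_coe_eq_algebraMap (𝓞 E) E w'.1 k).symm
    rw [hkw]
    exact hku w'.1 (by rw [w'.2]; exact hu)
  rw [hE, adeleAddCharAt_eq_of_sub_mem F v hv' hu', Algebra.trace_trace]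

/-- **the same in the `AddChar.adicComponent` spelling** of ★ (d1) `unipDeltaChar_locToAdelic_eq_prod` ∕ ★∕📤 B4 `integral_unipDeltaLoc_eq_integral_skew_addChar`
(`(adeleAddChar K).adicComponent u = adeleAddCharAt K u`, definitionally): B4's letter `hΨ` with `ψ := adeleAddCharAt F v` and `τ := Algebra.trace F_v (E ⊗ F_v)`.
[cite: CasselsFrohlichANT1967, Ch. XV (Tate) §2.2, §4.1] -/
theorem prod_adicComponent_adeleAddChar_eq (y : LocalRing E v) :
    ∏ w : PlacesOver E v, (adeleAddChar E).adicComponent w.1 (y w) = adeleAddCharAt F v (Algebra.trace (v.adicCompletion F) (LocalRing E v) y) :=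
  prod_adeleAddCharAt_eq_adeleAddCharAt_trace E v y

end Tate

end Summit.HodgeConjecture.HodgeConjecture.Cruxes.HLiu418.K2LiuTateCharacterLocalTrace

end
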